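import Summits.NavierStokesRegularity.NavierStokesRegularity.Theorems.StrainDoorsNearRecordSecondOrderTools
import HarnessLib

/-!
# StrainDoorsNearRecordSecondOrderRate — PART M §M8–§M9: THE SECOND-ORDER NEAR-RECORD LAWS WITH THE RATE `δ^{1/3}`

(Tree file 2 of 3 of PART M (§M8/§M9, ROUND 63 text C); text of nsreg-p1 r63/StrainDoorsNearRecordSecondOrderRate.lean sha256 97e6be56218c081e, split at the 400-line cap at § boundaries,
bodies verbatim; imports file 1 `StrainDoorsNearRecordSecondOrderTools`.)

nsreg-p1 g36, ROUND-63 (helper lane of `stmt-NavierStokesRegularity-0056`, rung N0; 0 ledger writes by the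
planner — text for the S-lane, `--supports stmt-NavierStokesRegularity-0056 --as helper`; tree file 3 of 5 of
ROUND-63, independent of files 1–2; bodies farm-certified inside `r63/StrainDoorsR63All.lean`, rc 0 · 0 warn ·
0 sorry, std axioms).

§M8 (the `k = 4` KNSS window): `window_transfer_D4`, `exists_uniform_D4Bound` (`‖D⁴u(t,·)‖ ≤ K₄(C₀)` for
`t ≤ −1/4` in the classical Type-I class on `(−∞,0) × ℝ³`), `exists_uniform_D3Lipschitz` (`‖D³u‖ ≤ K₃`,
`‖D³u(t,x) − D³u(t,y)‖ ≤ K₄|x − y|`).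

§M9 (the laws): at a near-record of `|ω'|²` at time `−1` the symmetric second difference along a unit direction
`e` is `≤ 2(W² − |ω'(z)|²) ≤ 4Wδ`, and `∂_e∂_e|ω'|²` is Lipschitz along lines by §M8; the cubic symmetric Taylor
estimate gives `∂_e∂_e|ω'|²(z)·s² ≤ 4Wδ + 2K s³` for all `s > 0`, whence the RATE `δ^{1/3}`:
* `cube_le_of_forall_sq_le`, `abs_symm_second_difference_sub_le`, `second_deriv_cube_le_of_le` — Fermat at a
  near-maximum, SECOND ORDER, with a rate (one real variable);
* `fderiv_curl_nsRescale`, `fderiv_fderiv_curl_apply_nsRescale` — scale laws of `∇ω` (`λ³`) and `∂_e∂_e ω` (`λ⁴`);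
* ★★★ `typeI_vorticity_secondOrder_deficit` — `[(0 − t)³ (|∂_e ω|² + ⟪ω, ∂_e∂_e ω⟫)(t,x)]³ ≤ A(C₀)·W·δ` for
  every unit `e`, whenever `(0 − t)|ω(t,·)| ≤ W` at that instant and `(0 − t)|ω(t,x)| ≥ W − δ`;
* ★★ `typeI_vorticity_laplacian_deficit` — summed over a frame:
  `[(0 − t)³ (|∇ω|²_F + ⟪ω, Δω⟫)(t,x)]³ ≤ 27A·W·δ` (`½Δ|ω|² = |∇ω|²_F + ⟪ω,Δω⟫`);
* `typeI_vorticity_laplacian_nonpos_at_max` — sanity (`δ = 0`): the classical `Δ|ω|² ≤ 0` at a maximum.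

WHAT THIS IS NOT: necessary conditions at near-record points; nothing here excludes a blow-up; `0056` / `10661` /
NS regularity are NOT proved; the peak doors of PART K stay OPEN.  No new definitions; no sorry.
[cite: KochNadirashviliSereginSverak2009, §2 p. 5, §4 (4.11); ChaeWolf2017RemovingDSS, §3 Step 2;
ConstantinFefferman1993, §1]
-/

noncomputable section

open MeasureTheory Set Function Filter Metric Real InnerProductSpace
open _root_.Topology
open scoped ENNReal NNReal RealInnerProductSpace ContDiff Laplacian
open Literature.Analysis Literature.Analysis.FluidPDE
open Literature.Analysis.FluidPDE.VorticityDirectionDynamics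

set_option linter.dupNamespace false
set_option maxSynthPendingDepth 3

namespace Summit.NavierStokesRegularity.NavierStokesRegularity.Theorems.StrainDoors

open Summit.NavierStokesRegularity.NavierStokesRegularity.Theorems.ArgmaxDoors

set_option maxHeartbeats 400000 in
/-- ★★★ **THE SECOND-ORDER NEAR-RECORD LAW WITH THE RATE `δ^{1/3}` (compactness-free).**  There is
`A = A(C₀) ≥ 0` such that for every classical Type-I solution on `(−∞,0) × ℝ³`, every `t < 0`, every bound
`(0 − t)|ω(t,·)| ≤ W` AT THAT INSTANT, every point `x` with `(0 − t)|ω(t,x)| ≥ W − δ` (`δ ≥ 0`) and every unit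
direction `e`:
`[(0 − t)³ · ( |∂_e ω(t,x)|² + ⟪ω(t,x), ∂_e∂_e ω(t,x)⟫ )]³ ≤ A · W · δ`,
i.e. the scale-invariant second directional derivative `½ ∂_e∂_e |ω|²` is `≤ (A W δ)^{1/3}` at near-records —
along EVERY direction, not only on average.  At an exact record (`δ = 0`) this is the classical second-order
condition `∂_e∂_e|ω|² ≤ 0`; the content is the RATE, which needs no blow-up sequence and no compactness: it is
the cubic symmetric Taylor estimate for `|ω'|²` at time `−1` with the uniform `C^{3,1}` bounds of the Type-I
class (the `k = 4` KNSS window, §M8).  Summing over an orthonormal frame gives the near-record law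
`(0 − t)³ (|∇ω|² + ⟪ω, Δω⟫) ≤ 3 (A W δ)^{1/3}` (typed in the memo). [new-as-typed] -/
theorem typeI_vorticity_secondOrder_deficit {C₀ : ℝ} (hC₀ : 0 ≤ C₀) :
    ∃ A : ℝ, 0 ≤ A ∧
      ∀ (u : ℝ → (EuclideanSpace ℝ (Fin 3)) → (EuclideanSpace ℝ (Fin 3))) (p : ℝ → (EuclideanSpace ℝ (Fin 3)) → ℝ)
        (W t δ : ℝ) (x e : EuclideanSpace ℝ (Fin 3)),
        IsClassicalNSSolutionOn (Iio 0) 1 0 u p → HasTypeIDecay C₀ u → t < 0 →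
        (∀ y, (0 - t) * ‖curl (u t) y‖ ≤ W) → 0 ≤ δ → W - δ ≤ (0 - t) * ‖curl (u t) x‖ → ‖e‖ = 1 →
        ((0 - t) ^ 3 * (‖fderiv ℝ (curl (u t)) x e‖ ^ 2 +
            ⟪curl (u t) x, fderiv ℝ (fun y => fderiv ℝ (curl (u t)) y e) x e⟫)) ^ 3 ≤ A * W * δ := by
  obtain ⟨B, hB, hBb⟩ := typeI_vorticityNumber_bound hC₀
  obtain ⟨K₂, L₁, hK₂, hL₁, hG⟩ := exists_uniform_gradLipschitz hC₀
  obtain ⟨K₂', K₃', hK₂', hK₃', hH⟩ := exists_uniform_hessLipschitz hC₀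
  obtain ⟨K₃'', K₄, hK₃'', hK₄, hT3⟩ := exists_uniform_D3Lipschitz hC₀
  obtain ⟨c, hc⟩ : ∃ c : ℝ, c = ‖(curlCLM : ((EuclideanSpace ℝ (Fin 3)) →L[ℝ] (EuclideanSpace ℝ (Fin 3))) →L[ℝ]
      (EuclideanSpace ℝ (Fin 3)))‖ := ⟨_, rfl⟩
  have hc0 : 0 ≤ c := by rw [hc]; exact norm_nonneg _
  obtain ⟨K, hKdef⟩ : ∃ K : ℝ,
      K = 2 * ((c * K₂) * (c * K₃'') + B * (c * K₄) + 2 * ((c * K₃') * (c * K₂'))) := ⟨_, rfl⟩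
  have hK0 : 0 ≤ K := by rw [hKdef]; positivity
  refine ⟨16 * K ^ 2, by positivity, fun u p W t δ x e hsol hI ht hdom hδ hnear he => ?_⟩
  have h14 : (-1 : ℝ) ≤ -(1 / 4 : ℝ) := by norm_num
  -- rescale to time `-1`
  obtain ⟨lam, hlam⟩ : ∃ lam : ℝ, lam = √(0 - t) := ⟨_, rfl⟩
  have hlam0 : 0 < lam := by rw [hlam]; exact Real.sqrt_pos.mpr (by linarith)
  have hlam2 : lam ^ 2 = 0 - t := by rw [hlam]; exact Real.sq_sqrt (by linarith)
  have ht1 : lam ^ 2 * (-1) = t := by rw [hlam2]; ring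
  obtain ⟨z, hz⟩ : ∃ z : EuclideanSpace ℝ (Fin 3), z = lam⁻¹ • x := ⟨_, rfl⟩
  have hxz : lam • z = x := by rw [hz]; exact smul_inv_smul₀ hlam0.ne' _
  have hcl := (typeI_class_nsRescale hlam0 hsol hI).1
  have hI' := (typeI_class_nsRescale hlam0 hsol hI).2
  -- the data at time `-1`: `w = ω'`, `Dw = curlCLM ∘ D²u'`, `T = D³u'`, and their uniform bounds
  obtain ⟨w, hw⟩ : ∃ w : (EuclideanSpace ℝ (Fin 3)) → (EuclideanSpace ℝ (Fin 3)),
      w = curl (nsRescale lam u (-1)) := ⟨_, rfl⟩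
  obtain ⟨Dw, hDw⟩ : ∃ Dw : (EuclideanSpace ℝ (Fin 3)) → ((EuclideanSpace ℝ (Fin 3)) →L[ℝ]
      (EuclideanSpace ℝ (Fin 3))),
      Dw = fun y => curlCLM.comp (fderiv ℝ (fderiv ℝ (nsRescale lam u (-1))) y) := ⟨_, rfl⟩
  obtain ⟨T, hT⟩ : ∃ T : (EuclideanSpace ℝ (Fin 3)) → ((EuclideanSpace ℝ (Fin 3)) →L[ℝ]
      ((EuclideanSpace ℝ (Fin 3)) →L[ℝ] ((EuclideanSpace ℝ (Fin 3)) →L[ℝ] (EuclideanSpace ℝ (Fin 3))))),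
      T = fun y => fderiv ℝ (fderiv ℝ (fderiv ℝ (nsRescale lam u (-1)))) y := ⟨_, rfl⟩
  obtain ⟨cT, hcT⟩ : ∃ cT : (EuclideanSpace ℝ (Fin 3)) → (EuclideanSpace ℝ (Fin 3)),
      cT = fun y => curlCLM (((T y) e) e) := ⟨_, rfl⟩
  have hWdom : ∀ y, ‖w y‖ ≤ W := fun y => by
    have h := hdom (lam • y)
    rw [← ht1, ← vorticityNumber_nsRescale] at h
    norm_num at h
    rw [hw]
    exact h
  have hnear' : W - δ ≤ ‖w z‖ := by
    have h := hnear
    rw [← hxz, ← ht1, ← vorticityNumber_nsRescale] at h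
    norm_num at h
    rw [hw]
    linarith
  have hwB : ∀ y, ‖w y‖ ≤ B := fun y => by
    have h := hBb hcl hI' (-1) (by norm_num) y
    norm_num at h
    rw [hw]
    exact h
  have h10 : (-1 : ℝ) ∈ Iio 0 := by norm_num
  have hHd : ∀ y, HasFDerivAt (fderiv ℝ (nsRescale lam u (-1)))
      (fderiv ℝ (fderiv ℝ (nsRescale lam u (-1))) y) y := fun y =>
    ((((hcl.contDiff_velocity h10).fderiv_right (m := 1) (by norm_cast)).differentiable (by norm_cast))
      y).hasFDerivAt
  have hTd : ∀ y, HasFDerivAt (fderiv ℝ (fderiv ℝ (nsRescale lam u (-1)))) (T y) y := fun y => by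
    rw [hT]
    exact (((((hcl.contDiff_velocity h10).fderiv_right (m := 2) (by norm_cast)).fderiv_right (m := 1)
      (by norm_cast)).differentiable (by norm_cast)) y).hasFDerivAt
  have hwd : ∀ y, HasFDerivAt w (Dw y) y := fun y => by
    rw [hw, hDw]
    exact hasFDerivAt_curl_of_hasFDerivAt_fderiv (hHd y)
  have hFe : ∀ y, HasFDerivAt (fun y => (fderiv ℝ (fderiv ℝ (nsRescale lam u (-1))) y) e)
      ((ContinuousLinearMap.apply ℝ ((EuclideanSpace ℝ (Fin 3)) →L[ℝ] (EuclideanSpace ℝ (Fin 3))) e).comp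
        (T y)) y := fun y => by
    have h := (ContinuousLinearMap.apply ℝ ((EuclideanSpace ℝ (Fin 3)) →L[ℝ] (EuclideanSpace ℝ (Fin 3)))
      e).hasFDerivAt.comp y (hTd y)
    simpa only [Function.comp_def, ContinuousLinearMap.apply_apply] using h
  have hDwe : ∀ y, HasFDerivAt (fun y => Dw y e)
      (curlCLM.comp ((ContinuousLinearMap.apply ℝ ((EuclideanSpace ℝ (Fin 3)) →L[ℝ]
        (EuclideanSpace ℝ (Fin 3))) e).comp (T y))) y := fun y => by
    rw [hDw]
    exact curlCLM.hasFDerivAt.comp y (hFe y)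
  have hDwB : ∀ y, ‖Dw y‖ ≤ c * K₂' := fun y => by
    rw [hDw, hc]
    exact (ContinuousLinearMap.opNorm_comp_le _ _).trans
      (mul_le_mul_of_nonneg_left ((hH hcl hI').1 (-1) h14 y) (norm_nonneg _))
  have hDwL : ∀ a b, ‖Dw a - Dw b‖ ≤ c * K₃' * ‖a - b‖ := fun a b => by
    rw [hDw, hc]
    dsimp only
    rw [← ContinuousLinearMap.comp_sub, mul_assoc]
    exact (ContinuousLinearMap.opNorm_comp_le _ _).trans
      (mul_le_mul_of_nonneg_left ((hH hcl hI').2 (-1) h14 a b) (norm_nonneg _))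
  have hwL : ∀ a b, ‖w a - w b‖ ≤ c * K₂ * ‖a - b‖ := fun a b => by
    rw [hw, hc]
    exact curl_sub_le_of_fderiv_lipschitz ((hG hcl hI').1 (-1) h14) a b
  have hcTB : ∀ y, ‖cT y‖ ≤ c * K₃'' := fun y => by
    rw [hcT, hc]
    refine (ContinuousLinearMap.le_opNorm _ _).trans (mul_le_mul_of_nonneg_left ?_ (norm_nonneg _))
    calc ‖((T y) e) e‖ ≤ ‖(T y) e‖ * ‖e‖ := ContinuousLinearMap.le_opNorm _ _
      _ ≤ ‖T y‖ * ‖e‖ * ‖e‖ := mul_le_mul_of_nonneg_right (ContinuousLinearMap.le_opNorm _ _) (norm_nonneg _)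
      _ = ‖T y‖ := by rw [he, mul_one, mul_one]
      _ ≤ K₃'' := by rw [hT]; exact (hT3 hcl hI').1 (-1) h14 y
  have hcTL : ∀ a b, ‖cT a - cT b‖ ≤ c * K₄ * ‖a - b‖ := fun a b => by
    rw [hcT, hc]
    dsimp only
    rw [← map_sub, mul_assoc]
    refine (ContinuousLinearMap.le_opNorm _ _).trans (mul_le_mul_of_nonneg_left ?_ (norm_nonneg _))
    rw [show ((T a) e) e - ((T b) e) e = ((T a - T b) e) e from rfl]
    calc ‖((T a - T b) e) e‖ ≤ ‖(T a - T b) e‖ * ‖e‖ := ContinuousLinearMap.le_opNorm _ _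
      _ ≤ ‖T a - T b‖ * ‖e‖ * ‖e‖ :=
          mul_le_mul_of_nonneg_right (ContinuousLinearMap.le_opNorm _ _) (norm_nonneg _)
      _ = ‖T a - T b‖ := by rw [he, mul_one, mul_one]
      _ ≤ K₄ * ‖a - b‖ := by rw [hT]; exact (hT3 hcl hI').2 (-1) h14 a b
  have hDweB : ∀ y, ‖Dw y e‖ ≤ c * K₂' := fun y =>
    (ContinuousLinearMap.le_opNorm _ _).trans (by rw [he, mul_one]; exact hDwB y)
  have hDweL : ∀ a b, ‖Dw a e - Dw b e‖ ≤ c * K₃' * ‖a - b‖ := fun a b => by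
    rw [show Dw a e - Dw b e = (Dw a - Dw b) e from rfl]
    exact (ContinuousLinearMap.le_opNorm _ _).trans (by rw [he, mul_one]; exact hDwL a b)
  -- `f = |w|²` and its derivative
  obtain ⟨f, hf⟩ : ∃ f : (EuclideanSpace ℝ (Fin 3)) → ℝ, f = fun y => ‖w y‖ ^ 2 := ⟨_, rfl⟩
  obtain ⟨f', hf'⟩ : ∃ f' : (EuclideanSpace ℝ (Fin 3)) → ((EuclideanSpace ℝ (Fin 3)) →L[ℝ] ℝ),
      f' = fun y => (2 : ℝ) • (innerSL ℝ (w y)).comp (Dw y) := ⟨_, rfl⟩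
  have hfd' : ∀ y, HasFDerivAt f (f' y) y := fun y => by
    rw [hf, hf']
    exact (hwd y).norm_sq.congr_fderiv (by simp only [two_smul])
  -- the one-variable functions along the line `σ ↦ z + σ e`
  obtain ⟨G, hGdef⟩ : ∃ G : ℝ → ℝ, G = fun σ => ‖w (z + σ • e)‖ ^ 2 := ⟨_, rfl⟩
  obtain ⟨G', hG'def⟩ : ∃ G' : ℝ → ℝ, G' = fun σ => 2 * ⟪w (z + σ • e), Dw (z + σ • e) e⟫ := ⟨_, rfl⟩
  obtain ⟨G'', hG''def⟩ : ∃ G'' : ℝ → ℝ, G'' = fun σ =>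
      2 * (⟪w (z + σ • e), cT (z + σ • e)⟫ + ⟪Dw (z + σ • e) e, Dw (z + σ • e) e⟫) := ⟨_, rfl⟩
  have hℓ : ∀ σ : ℝ, HasDerivAt (fun σ : ℝ => z + σ • e) e σ := fun σ => by
    simpa using ((hasDerivAt_id σ).smul_const e).const_add z
  have hGd : ∀ σ, HasDerivAt G (G' σ) σ := fun σ => by
    rw [hGdef, hG'def]
    have h := (hfd' (z + σ • e)).comp_hasDerivAt σ (hℓ σ)
    rw [hf, hf'] at h
    simpa [Function.comp_def] using h
  have hG'd : ∀ σ, HasDerivAt G' (G'' σ) σ := fun σ => by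
    rw [hG'def, hG''def]
    have h1 : ∀ y, HasFDerivAt (fun y => ⟪w y, Dw y e⟫)
        ((fderivInnerCLM ℝ (w y, Dw y e)).comp ((Dw y).prod (curlCLM.comp
          ((ContinuousLinearMap.apply ℝ ((EuclideanSpace ℝ (Fin 3)) →L[ℝ] (EuclideanSpace ℝ (Fin 3)))
            e).comp (T y))))) y := fun y => (hwd y).inner (𝕜 := ℝ) (hDwe y)
    have h := ((h1 (z + σ • e)).const_mul (2 : ℝ)).comp_hasDerivAt σ (hℓ σ)
    rw [hcT]
    simpa [Function.comp_def, fderivInnerCLM_apply] using h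
  have hinner : ∀ a₁ a₂ b₁ b₂ : EuclideanSpace ℝ (Fin 3),
      |⟪a₁, b₁⟫ - ⟪a₂, b₂⟫| ≤ ‖a₁ - a₂‖ * ‖b₁‖ + ‖a₂‖ * ‖b₁ - b₂‖ := fun a₁ a₂ b₁ b₂ => by
    rw [show ⟪a₁, b₁⟫ - ⟪a₂, b₂⟫ = ⟪a₁ - a₂, b₁⟫ + ⟪a₂, b₁ - b₂⟫ by
      rw [inner_sub_left, inner_sub_right]; ring]
    exact (abs_add_le _ _).trans (add_le_add (abs_real_inner_le_norm _ _) (abs_real_inner_le_norm _ _))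
  have hLip : ∀ σ, |G'' σ - G'' 0| ≤ K * |σ| := fun σ => by
    rw [hG''def]
    dsimp only
    rw [zero_smul, add_zero]
    have hr : ‖(z + σ • e) - z‖ = |σ| := by
      rw [add_sub_cancel_left, norm_smul, he, mul_one, Real.norm_eq_abs]
    have hP : |⟪w (z + σ • e), cT (z + σ • e)⟫ - ⟪w z, cT z⟫| ≤
        ((c * K₂) * (c * K₃'') + B * (c * K₄)) * |σ| := by
      refine (hinner _ _ _ _).trans ?_
      have h1 : ‖w (z + σ • e) - w z‖ * ‖cT (z + σ • e)‖ ≤ (c * K₂ * |σ|) * (c * K₃'') :=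
        mul_le_mul (by rw [← hr]; exact hwL _ _) (hcTB _) (norm_nonneg _) (by positivity)
      have h2 : ‖w z‖ * ‖cT (z + σ • e) - cT z‖ ≤ B * (c * K₄ * |σ|) :=
        mul_le_mul (hwB z) (by rw [← hr]; exact hcTL _ _) (norm_nonneg _) hB
      calc _ ≤ (c * K₂ * |σ|) * (c * K₃'') + B * (c * K₄ * |σ|) := add_le_add h1 h2
        _ = _ := by ring
    have hQ : |⟪Dw (z + σ • e) e, Dw (z + σ • e) e⟫ - ⟪Dw z e, Dw z e⟫| ≤
        (2 * ((c * K₃') * (c * K₂'))) * |σ| := by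
      refine (hinner _ _ _ _).trans ?_
      have h1 : ‖Dw (z + σ • e) e - Dw z e‖ * ‖Dw (z + σ • e) e‖ ≤ (c * K₃' * |σ|) * (c * K₂') :=
        mul_le_mul (by rw [← hr]; exact hDweL _ _) (hDweB _) (norm_nonneg _) (by positivity)
      have h2 : ‖Dw z e‖ * ‖Dw (z + σ • e) e - Dw z e‖ ≤ (c * K₂') * (c * K₃' * |σ|) :=
        mul_le_mul (hDweB z) (by rw [← hr]; exact hDweL _ _) (norm_nonneg _) (by positivity)
      calc _ ≤ (c * K₃' * |σ|) * (c * K₂') + (c * K₂') * (c * K₃' * |σ|) := add_le_add h1 h2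
        _ = _ := by ring
    rw [← mul_sub, abs_mul, abs_of_pos (zero_lt_two' ℝ), hKdef,
      show ⟪w (z + σ • e), cT (z + σ • e)⟫ + ⟪Dw (z + σ • e) e, Dw (z + σ • e) e⟫ -
          (⟪w z, cT z⟫ + ⟪Dw z e, Dw z e⟫) =
        (⟪w (z + σ • e), cT (z + σ • e)⟫ - ⟪w z, cT z⟫) +
          (⟪Dw (z + σ • e) e, Dw (z + σ • e) e⟫ - ⟪Dw z e, Dw z e⟫) by ring]
    have h3 := abs_add_le (⟪w (z + σ • e), cT (z + σ • e)⟫ - ⟪w z, cT z⟫)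
      (⟪Dw (z + σ • e) e, Dw (z + σ • e) e⟫ - ⟪Dw z e, Dw z e⟫)
    calc _ ≤ 2 * (((c * K₂) * (c * K₃'') + B * (c * K₄)) * |σ| + (2 * ((c * K₃') * (c * K₂'))) * |σ|) :=
          mul_le_mul_of_nonneg_left (h3.trans (add_le_add hP hQ)) zero_le_two
      _ = _ := by ring
  -- Fermat at the near-maximum, second order, with a rate
  have hGM : ∀ σ, G σ ≤ W ^ 2 := fun σ => by
    rw [hGdef]
    exact pow_le_pow_left₀ (norm_nonneg _) (hWdom _) 2
  have hcube := second_deriv_cube_le_of_le hK0 hGd hG'd hLip hGM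
  have hW0 : 0 ≤ W := (norm_nonneg _).trans (hWdom z)
  have hdef : W ^ 2 - G 0 ≤ 2 * W * δ := by
    rw [hGdef]
    dsimp only
    rw [zero_smul, add_zero]
    have e1 : W ^ 2 - ‖w z‖ ^ 2 = (W - ‖w z‖) * (W + ‖w z‖) := by ring
    have e2 : (W - ‖w z‖) * (W + ‖w z‖) ≤ δ * (W + ‖w z‖) :=
      mul_le_mul_of_nonneg_right (by linarith) (by positivity)
    have e3 : δ * (W + ‖w z‖) ≤ δ * (2 * W) := mul_le_mul_of_nonneg_left (by linarith [hWdom z]) hδ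
    linarith
  have hcube' : G'' 0 ^ 3 ≤ 128 * K ^ 2 * W * δ :=
    hcube.trans ((mul_le_mul_of_nonneg_left hdef (by positivity : (0 : ℝ) ≤ 64 * K ^ 2)).trans_eq
      (by ring))
  have hG0 : G'' 0 = 2 * (‖Dw z e‖ ^ 2 + ⟪w z, cT z⟫) := by
    rw [hG''def]
    dsimp only
    rw [zero_smul, add_zero, real_inner_self_eq_norm_sq]
    ring
  -- back to `u`: the scale identities
  have hwz : w z = lam ^ 2 • curl (u t) x := by
    rw [hw, curl_eq_curlCLM, curl_eq_curlCLM, fderiv_nsRescale, map_smul, ht1, hxz]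
  have hDwz : Dw z e = (lam ^ 2 * lam) • fderiv ℝ (curl (u t)) x e := by
    rw [← (hwd z).fderiv, hw, fderiv_curl_nsRescale, ht1, hxz]
    rfl
  have hDw_eq : (fun y => Dw y e) = fun y => fderiv ℝ (curl (nsRescale lam u (-1))) y e := by
    funext y
    rw [← (hwd y).fderiv, hw]
  have hcTz : cT z = (lam ^ 2 * lam * lam) • fderiv ℝ (fun y => fderiv ℝ (curl (u t)) y e) x e := by
    have h1 : cT z = fderiv ℝ (fun y => Dw y e) z e := by
      rw [hcT, (hDwe z).fderiv]
      simp only [ContinuousLinearMap.coe_comp, Function.comp_apply, ContinuousLinearMap.apply_apply]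
    have h3 := fderiv_fderiv_curl_apply_nsRescale lam u (-1) z e
    rw [ht1, hxz] at h3
    have h5 := congrArg (fun F : (EuclideanSpace ℝ (Fin 3)) → (EuclideanSpace ℝ (Fin 3)) => fderiv ℝ F z e)
      hDw_eq
    rw [h1, h5, h3]
    rfl
  have hQ : (0 - t) ^ 3 * (‖fderiv ℝ (curl (u t)) x e‖ ^ 2 +
      ⟪curl (u t) x, fderiv ℝ (fun y => fderiv ℝ (curl (u t)) y e) x e⟫) = ‖Dw z e‖ ^ 2 + ⟪w z, cT z⟫ := by
    rw [← hlam2, hwz, hDwz, hcTz, norm_smul, real_inner_smul_left, real_inner_smul_right,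
      Real.norm_of_nonneg (by positivity)]
    ring
  rw [hQ, show ‖Dw z e‖ ^ 2 + ⟪w z, cT z⟫ = G'' 0 / 2 by rw [hG0]; ring]
  calc (G'' 0 / 2) ^ 3 = G'' 0 ^ 3 / 8 := by ring
    _ ≤ 128 * K ^ 2 * W * δ / 8 := div_le_div_of_nonneg_right hcube' (by norm_num)
    _ = 16 * K ^ 2 * W * δ := by ring

end Summit.NavierStokesRegularity.NavierStokesRegularity.Theorems.StrainDoors

end
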